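import Summits.QuantumFields.YangMills.Theorems.BalabanUVNodesN09ChartReadAveragingSubmersion
import Summits.QuantumFields.YangMills.Theorems.BalabanUVNodesN09BetaInputContinuousOffChi29Thresholds
import Literature.MeasureTheory.Integral.SubmersionPushforwardDensity
import Literature.MathematicalPhysics.QuantumFieldTheory.Balaban1983to89.HaarExpChartLocalFacePositivity
import Literature.MathematicalPhysics.QuantumFieldTheory.Balaban1983to89.Node00.RegSetOfLocalFaces
import HarnessLib

/-!
# BalabanUVNodes ∕ N09 — (F3) ON THE LOCAL ROUTE: THE CANONICAL TRANSPORT OF RECORD IS POSITIVE AT `Ū(U⋆)` WHENEVER THE DENSITY IS POSITIVE AND CONTINUOUS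
# AT A FINE CONFIGURATION `U⋆` OF THE LOOP α-GUARD AND `Ū(U⋆)` IS A REGULAR POINT — from LOCAL data only (no fibred chart, no global section)

Cell `pub-ymgap`, width seat `pub-ymgap-dag-n09-w2` generation 5 (HUMAN RULING D-0149; DAG node N09 = [Balaban1987RG1] §§2–5; INBOX CLAIM-2 l.37354, INTENT-4).
`--kind proof --supports stmt-QuantumFields-27364 --as helper` (K1⁹ `StabilityBRunRowsAtRecordR13SepCoPHV`; count-neutral; theorems only, 0 def ∕ 0 instance ∕ 0 notation ∕ 0 sorry).

WHY.  The regularity tower reads [I] (0.19) `A_{k+1} = log(𝐍_k⁻¹·T_kρ_k)` ON the next small-field domain, so besides the analytic inclusion `hreg_k` (road B: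
dag-n09-w2 g4 p630065 + dag-n09-w3 g5's junction) its corner `continuousOn_effActionHT_succ_of_subset_regSetOfRecord_of_pos` (dag-n09-w1 g5) needs
`hpos : 0 < TcanOfRecord ρ_k V` at every `V` of the domain.  Road A obtains it from a fibred chart through the critical configuration
(`…N09TransportPositiveOnDomainOfFibredChart`, `…N09TowerOfPerBondCharts`); THIS FILE obtains it on ROAD B from LOCAL data: a point `U⋆` of the fibre over `V` inside the
loop α-guard at which `ρ` is continuous and positive, and `V` a point of the maximal regular set.  Mechanism: the chart-read averaging `ψ_{U⋆}` is a `C¹` SUBMERSION at `0`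
(dag-n09-w4 g5), so this seat's engine WITH POSITIVITY (`SubmersionPushforward.exists_continuousOn_density_map_of_submersion_pos`, v1.1) gives, for a continuous bump
below `(ρ∘Θ^B(·)·U⋆)·J` at chart level, a push-forward density continuous and POSITIVE at `ψ_{U⋆}(0)`; the generic transfer
`PushforwardDensityPositivity.density_pos_of_chartRead` (this seat, g5) compares the masses of the small sets `Θ^{B'}(W)·V` at chart and group level through p28's
translated exponential charts (`IsChartRep.chartData_piExpChart_translate`) and concludes that ANY super-density of `Ū_*(ρ·dU)` continuous at `V` — here
`TcanOfRecord ρ` on `regSetOfRecord ρ` — is positive at `V`.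

CONTENTS (theorems only; nothing of NODE 00 ∕ p28 ∕ w1 ∕ w3 ∕ w4 restated).
§1 `TcanOfRecord_nonneg` (everywhere, for `ρ ≥ 0`), ★ `withDensity_preimage_eq_setLIntegral_TcanOfRecord` (the push-forward identity of `isRT_TcanOfRecord` on SETS, in `ℝ≥0∞`).
§2 ★★★ `TcanOfRecord_pos_of_localRoute` — `k < K`; `ρ ≥ 0` measurable and integrable ((I19)); `U⋆` in the loop α-guard (standing range), `ρ` continuous at `U⋆`, `0 < ρ U⋆`,
   `Ū(U⋆) ∈ regSetOfRecord F N K k ρ` ⟹ `0 < TcanOfRecord F N K k ρ (Ū(U⋆))`.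
§3 ★★ `TcanOfRecord_pos_of_localRoute_of_avg_eq` (the same at a prescribed `V = Ū(U⋆)`), ★★ `TcanOfRecord_pos_on_of_localRoute` (the tower's `hpos` binder on a set
   `Dom ⊆ regSetOfRecord` from a fibre-point selector `U⋆(V)` with the three local properties — at the record `U⋆(V) := V^{(k)}(V)`, [I] (2.3)).

HONEST FRAMING.  LOCATED, count-neutral measure theory BY NAME; the α-guard at `U⋆`, the continuity and positivity of `ρ` at `U⋆` and the regularity of `Ū(U⋆)` are
DISPLAYED (at the record: Prop 2-type smallness of the critical configuration, N07's continuity of the minimiser via dag-n09-w2 g5's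
`…N09BetaInputContinuousOffChi29Thresholds`, and `hreg`); NOTHING of Bałaban's asserted; `hreg`∕(F3)∕`contTOn` NOT discharged at the record; N09 NOT discharged; conjunct 1
(Lemma 4) ∕ FLAG №7 untouched; K0⁷ ∕ K1⁹ ∕ K2⁹ ∕ K3⁸ NOT closed; counts unmoved (typed 28∕28 · discharged 5∕28); no summit statement is proved here; R4 = the conditional
finite-𝕋⁴ rung `BalabanLadder.UV` only — NOT continuum ∕ ℝ⁴ ∕ OS; the Yang–Mills mass gap (Clay) is NOT proved by any of this.
-/

noncomputable section

open Filter Topology Set Function MeasureTheory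
open scoped ENNReal NNReal Matrix.Norms.L2Operator

namespace Summit.QuantumFields.YangMills.BalabanUVNodes.N09TransportPositiveOfLocalRoute

open Literature.MathematicalPhysics.QuantumFieldTheory.Balaban1983to89
open Literature.MathematicalPhysics.QuantumFieldTheory.Balaban1983to89.HaarExponentialChart
open Literature.MathematicalPhysics.QuantumFieldTheory.Balaban1983to89.HaarExponentialChart.IsChartRep
open Literature.MathematicalPhysics.QuantumFieldTheory.Balaban1983to89.BlockAveraging (Small Idx avgFun loopHol)
open Literature.MathematicalPhysics.QuantumFieldTheory.Balaban1983to89.ExpMeanLog (expMeanLogSU deltaSU)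
open Literature.MathematicalPhysics.QuantumFieldTheory.Balaban1983to89.Node00
open Literature.MathematicalPhysics.QuantumFieldTheory.Balaban1983to89.T4Continuum (T4Family)
open Literature.MathematicalPhysics.QuantumFieldTheory.Balaban1983to89.FieldMeasureExpChartChangeOfVariables
  (isHaarMeasure_haar_specialUnitaryGroup isMulRightInvariant_haar fieldMeasure_eq_pi)
open Literature.MeasureTheory.Integral.SubmersionPushforward (exists_continuousOn_density_map_of_submersion_pos)
open Summit.QuantumFields.YangMills.BalabanUVNodes.N09ChartReadAveragingSmooth
open Summit.QuantumFields.YangMills.BalabanUVNodes.N09ChartReadAveragingSubmersion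
open Summit.QuantumFields.YangMills.BalabanUVNodes.N09TransportPositiveOnDomainOfFibredChart
  (betaInput_chi29_nonneg betaInput_chi29_critCfgOfRecord_pos fluctDevOfRecord_critCfgOfRecord)
open Summit.QuantumFields.YangMills.BalabanUVNodes.N09BetaInputContinuousOffChi29Thresholds
  (continuousAt_betaInput_chi29_of_forall_ne continuousAt_fluctDevOfRecord_of_continuousAt_crit)

variable {F : T4Family} {N : ℕ} [NeZero N]

/-! ## §1 The canonical transport of a non-negative density is non-negative; its push-forward identity on sets -/

section Identity

variable {K k : ℕ}

/-- `TcanOfRecord ρ ≥ 0` EVERYWHERE for `ρ ≥ 0`: off the maximal regular set it is the kernel transform (`transportOfRecord_nonneg`); on it, it is continuous and a.e. equal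
to that non-negative transform, and the product Haar measure charges open sets. [cite: Balaban1987RG1, (0.13) p.254 (bookkeeping)] -/
theorem TcanOfRecord_nonneg {ρ : Density (F.P K) k (SU N)} (hρ0 : ∀ U, 0 ≤ ρ U) (V : PBond (F.P K) (k + 1) → SU N) :
    0 ≤ TcanOfRecord F N K k ρ V := by
  by_cases hV : V ∈ regSetOfRecord F N K k ρ
  · by_contra hneg
    rw [not_le] at hneg
    haveI := isOpenPosMeasure_piHaar_SUN N (F.P K) (k + 1)
    have hO : IsOpen (regSetOfRecord F N K k ρ ∩ (fun V => TcanOfRecord F N K k ρ V) ⁻¹' Iio 0) :=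
      (continuousOn_TcanOfRecord K k ρ).isOpen_inter_preimage (isOpen_regSetOfRecord K k ρ) isOpen_Iio
    have hpos : 0 < piHaar (F.P K) (k + 1) (SU N) (regSetOfRecord F N K k ρ ∩ (fun V => TcanOfRecord F N K k ρ V) ⁻¹' Iio 0) :=
      hO.measure_pos _ ⟨V, hV, hneg⟩
    have hae : ∀ᵐ W ∂piHaar (F.P K) (k + 1) (SU N), 0 ≤ TcanOfRecord F N K k ρ W := by
      filter_upwards [TcanOfRecord_ae_eq (F := F) (N := N) K k ρ] with W hW
      rw [hW]; exact transportOfRecord_nonneg F N K k ρ hρ0 W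
    have hnull : piHaar (F.P K) (k + 1) (SU N) (regSetOfRecord F N K k ρ ∩ (fun V => TcanOfRecord F N K k ρ V) ⁻¹' Iio 0) = 0 :=
      measure_mono_null (fun W hW => show ¬ 0 ≤ TcanOfRecord F N K k ρ W from not_le.2 hW.2) (ae_iff.1 hae)
    exact absurd hnull hpos.ne'
  · rw [TcanOfRecord_eq_of_not_mem ρ hV]
    exact transportOfRecord_nonneg F N K k ρ hρ0 V

/-- ★ **THE PUSH-FORWARD IDENTITY OF THE CANONICAL TRANSPORT ON SETS** (`ℝ≥0∞` form): for `k < K` and `ρ ≥ 0` integrable,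
`(ρ·dU)(Ū⁻¹ B) = ∫⁻_B TcanOfRecord ρ dV` for every measurable set `B` of coarse fields — `isRT_TcanOfRecord` tested against `𝟙_B` (`ρ ≥ 0` integrable, `k < K`).
[cite: Balaban1987RG1, (0.13) p.254; Balaban1988Convergent, (3.1) p.264] -/
theorem withDensity_preimage_eq_setLIntegral_TcanOfRecord (hk : k < K) {ρ : Density (F.P K) k (SU N)} (hρ0 : ∀ U, 0 ≤ ρ U)
    (hρi : Integrable ρ (fieldMeasure (F.P K) k (SU N))) {B : Set (GaugeField (F.P K) (k + 1) (SU N))} (hB : MeasurableSet B) :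
    ((fieldMeasure (F.P K) k (SU N)).withDensity fun U => ENNReal.ofReal (ρ U)) ((avOfRecord F N K k).avg ⁻¹' B) =
      ∫⁻ V in B, ENNReal.ofReal (TcanOfRecord F N K k ρ V) ∂(fieldMeasure (F.P K) (k + 1) (SU N)) := by
  have hMm := avOfRecord_measurable F N K k
  have hTi := integrable_TcanOfRecord (F := F) (N := N) hk hρi
  -- the IsRT identity against `𝟙_B`
  have hind1 : ∀ V, TcanOfRecord F N K k ρ V * B.indicator (fun _ => (1 : ℝ)) V = B.indicator (fun W => TcanOfRecord F N K k ρ W) V := by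
    intro V
    by_cases h : V ∈ B
    · rw [indicator_of_mem h, indicator_of_mem h, mul_one]
    · rw [indicator_of_notMem h, indicator_of_notMem h, mul_zero]
  have hind2 : ∀ U, ρ U * B.indicator (fun _ => (1 : ℝ)) ((avOfRecord F N K k).avg U) =
      ((avOfRecord F N K k).avg ⁻¹' B).indicator (fun W => ρ W) U := by
    intro U
    by_cases h : (avOfRecord F N K k).avg U ∈ B
    · rw [indicator_of_mem h, indicator_of_mem (show U ∈ (avOfRecord F N K k).avg ⁻¹' B from h), mul_one]
    · rw [indicator_of_notMem h, indicator_of_notMem (show U ∉ (avOfRecord F N K k).avg ⁻¹' B from h), mul_zero]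
  have hbd : ∃ C : ℝ, ∀ V, |B.indicator (fun _ => (1 : ℝ)) V| ≤ C := by
    refine ⟨1, fun V => ?_⟩
    by_cases h : V ∈ B
    · rw [indicator_of_mem h, abs_one]
    · rw [indicator_of_notMem h, abs_zero]; exact zero_le_one
  have hRT := isRT_TcanOfRecord (F := F) (N := N) hk hρi (B.indicator fun _ => (1 : ℝ)) (measurable_const.indicator hB) hbd
  have hL : ∫ V, TcanOfRecord F N K k ρ V * B.indicator (fun _ => (1 : ℝ)) V ∂fieldMeasure (F.P K) (k + 1) (SU N) =
      ∫ V in B, TcanOfRecord F N K k ρ V ∂fieldMeasure (F.P K) (k + 1) (SU N) := by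
    refine (integral_congr_ae (Filter.Eventually.of_forall hind1)).trans ?_
    exact integral_indicator hB
  have hR : ∫ U, ρ U * B.indicator (fun _ => (1 : ℝ)) ((avOfRecord F N K k).avg U) ∂fieldMeasure (F.P K) k (SU N) =
      ∫ U in (avOfRecord F N K k).avg ⁻¹' B, ρ U ∂fieldMeasure (F.P K) k (SU N) := by
    refine (integral_congr_ae (Filter.Eventually.of_forall hind2)).trans ?_
    exact integral_indicator (hMm hB)
  rw [hL, hR] at hRT
  -- convert both sides to `ℝ≥0∞`
  rw [withDensity_apply _ (hMm hB),
    ← ofReal_integral_eq_lintegral_ofReal hρi.integrableOn (Filter.Eventually.of_forall fun U => hρ0 U),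
    ← ofReal_integral_eq_lintegral_ofReal hTi.integrableOn (Filter.Eventually.of_forall fun V => TcanOfRecord_nonneg hρ0 V), hRT]

end Identity

/-! ## §2 Positivity of the canonical transport at `Ū(U⋆)` from local data at `U⋆` -/

section Positive

variable {K k : ℕ}

/-- ★★★ **(F3) ON THE LOCAL ROUTE.**  `k < K`; `ρ ≥ 0` a measurable, integrable step-`k` density; `U⋆` a fine configuration in the loop α-guard (standing range
`α ≤ 1∕24`, `α < δ_N`, `157·α < L^{1−d}`) at which `ρ` is CONTINUOUS and POSITIVE; `Ū(U⋆)` a point of the maximal regular set of the transform of `ρ`.  THEN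
`0 < TcanOfRecord F N K k ρ (Ū(U⋆))`.  Proof: the chart-read averaging `ψ_{U⋆}` is a `C¹` submersion at `0` (dag-n09-w4 g5's `contDiffAt_chartRead_avgFun`,
`fderiv_chartRead_avgFun_range_eq_top`), so this seat's engine with positivity (`SubmersionPushforward.exists_continuousOn_density_map_of_submersion_pos`) gives the
flat face WITH POSITIVITY of `ψ_{U⋆}` at `0`; this seat's group-level transfer `IsChartRep.density_pos_pi_haar_of_chartRead` (p28's translated exponential charts on
both sides, a continuous bump below `(ρ∘Θ^B(·)·U⋆)·J`, comparison of the masses of small chart images) applies to the super-density `TcanOfRecord ρ` (§1; continuous on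
the regular set). [cite: Balaban1987RG1, (0.13) p.254, (0.19) p.255 and (2.10) p.267] [cite: Helgason2000, Ch. I §1 Thm. 1.14 (13) p. 96] [cite: EvansGariepy1992, §3.4.3 Thm 2] -/
theorem TcanOfRecord_pos_of_localRoute (hk : k < K) {α : ℝ} (hα24 : α ≤ 1 / 24) (hαδ : α < deltaSU (Fin N))
    (hαL : 157 * α < (((F.P K).L : ℝ) ^ ((F.P K).d - 1))⁻¹) {ρ : Density (F.P K) k (SU N)}
    (hρm : Measurable ρ) (hρ0 : ∀ U, 0 ≤ ρ U) (hρi : Integrable ρ (fieldMeasure (F.P K) k (SU N)))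
    {Us : GaugeField (F.P K) k (SU N)} (hUα : ∀ c i, dist1 (loopHol Us c i) ≤ α)
    (hρc : ContinuousAt ρ Us) (hρpos : 0 < ρ Us)
    (hreg : (avOfRecord F N K k).avg Us ∈ regSetOfRecord F N K k ρ) :
    0 < TcanOfRecord F N K k ρ ((avOfRecord F N K k).avg Us) := by
  classical
  -- the Lie model of the chart as a Borel space with an additive Haar measure; Haar instances on `SU(N)`
  letI : MeasurableSpace (specialUnitaryLogChart (Fin N)).lie := borel _
  haveI : BorelSpace (specialUnitaryLogChart (Fin N)).lie := ⟨rfl⟩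
  haveI := isHaarMeasure_haar_specialUnitaryGroup (N := N)
  haveI : (HaarData.haar : Measure (SU N)).IsMulRightInvariant := isMulRightInvariant_haar
  haveI : (Measure.pi fun _ : PBond (F.P K) k =>
      (Module.finBasis ℝ (specialUnitaryLogChart (Fin N)).lie).addHaar).IsAddHaarMeasure := Measure.pi.isAddHaarMeasure _
  haveI : (Measure.pi fun _ : PBond (F.P K) (k + 1) =>
      (Module.finBasis ℝ (specialUnitaryLogChart (Fin N)).lie).addHaar).IsAddHaarMeasure := Measure.pi.isAddHaarMeasure _
  -- the local data at `U⋆`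
  have hsmall : ∀ c, Small (expMeanLogSU (n := Fin N)) Us c := fun c i => lt_of_le_of_lt (hUα c i) hαδ
  have hj : k + 1 ≤ (F.P K).m + (F.P K).K := by simp only [T4Continuum.T4Family.P_K]; omega
  -- the flat face WITH POSITIVITY of the chart-read averaging at `0` (this seat's engine over dag-n09-w4's submersion data)
  have hflat := exists_continuousOn_density_map_of_submersion_pos
    (Measure.pi fun _ : PBond (F.P K) k => (Module.finBasis ℝ (specialUnitaryLogChart (Fin N)).lie).addHaar)
    (Measure.pi fun _ : PBond (F.P K) (k + 1) => (Module.finBasis ℝ (specialUnitaryLogChart (Fin N)).lie).addHaar)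
    (measurable_chartRead_avgFun (P := F.P K) (j := k) Us)
    ((contDiffAt_chartRead_avgFun (P := F.P K) (j := k) Us hsmall).of_le le_top)
    (fderiv_chartRead_avgFun_range_eq_top (P := F.P K) (j := k) hj hUα hα24 hαδ hαL)
  -- the super-density `TcanOfRecord ρ` of the push-forward, read w.r.t. the product Haar measures
  have hI : ∀ B : Set (PBond (F.P K) (k + 1) → SU N), MeasurableSet B → B ⊆ regSetOfRecord F N K k ρ →
      ((Measure.pi fun _ : PBond (F.P K) k => (HaarData.haar : Measure (SU N))).withDensity fun U => ENNReal.ofReal (ρ U))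
          ((avgFun (expMeanLogSU (n := Fin N)) : GaugeField (F.P K) k (SU N) → GaugeField (F.P K) (k + 1) (SU N)) ⁻¹' B) ≤
        ∫⁻ V in B, ENNReal.ofReal (TcanOfRecord F N K k ρ V) ∂(Measure.pi fun _ : PBond (F.P K) (k + 1) => (HaarData.haar : Measure (SU N))) := by
    intro B hB _
    have h1 := withDensity_preimage_eq_setLIntegral_TcanOfRecord (F := F) (N := N) hk hρ0 hρi hB
    rw [fieldMeasure_eq_pi, fieldMeasure_eq_pi] at h1
    exact h1.le
  -- the group-level transfer
  exact (isChartRep_specialUnitaryGroup (n := Fin N)).density_pos_pi_haar_of_chartRead (lie_adStable_specialUnitaryGroup (n := Fin N))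
    ((Module.finBasis ℝ (specialUnitaryLogChart (Fin N)).lie).addHaar) (HaarData.haar : Measure (SU N))
    (avOfRecord_measurable F N K k) Us (continuousAt_avgFun_of_small (P := F.P K) (j := k) Us hsmall) hflat
    hρm hρ0 hρc hρpos (isOpen_regSetOfRecord K k ρ) hreg
    ((continuousOn_TcanOfRecord K k ρ).continuousAt ((isOpen_regSetOfRecord K k ρ).mem_nhds hreg)) hI

/-- ★★ **THE SAME AT A PRESCRIBED COARSE FIELD**: if `Ū(U⋆) = V` then `0 < TcanOfRecord F N K k ρ V`. [cite: Balaban1987RG1, (0.19) p.255 and (2.10) p.267] -/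
theorem TcanOfRecord_pos_of_localRoute_of_avg_eq (hk : k < K) {α : ℝ} (hα24 : α ≤ 1 / 24) (hαδ : α < deltaSU (Fin N))
    (hαL : 157 * α < (((F.P K).L : ℝ) ^ ((F.P K).d - 1))⁻¹) {ρ : Density (F.P K) k (SU N)}
    (hρm : Measurable ρ) (hρ0 : ∀ U, 0 ≤ ρ U) (hρi : Integrable ρ (fieldMeasure (F.P K) k (SU N)))
    {Us : GaugeField (F.P K) k (SU N)} {V : PBond (F.P K) (k + 1) → SU N} (hUsV : (avOfRecord F N K k).avg Us = V)
    (hUα : ∀ c i, dist1 (loopHol Us c i) ≤ α) (hρc : ContinuousAt ρ Us) (hρpos : 0 < ρ Us)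
    (hreg : V ∈ regSetOfRecord F N K k ρ) :
    0 < TcanOfRecord F N K k ρ V := by
  subst hUsV
  exact TcanOfRecord_pos_of_localRoute hk hα24 hαδ hαL hρm hρ0 hρi hUα hρc hρpos hreg

/-- ★★ **THE TOWER'S `hpos` BINDER FROM A FIBRE-POINT SELECTOR**: on a set `Dom ⊆ regSetOfRecord F N K k ρ` of coarse fields, if every `V ∈ Dom` carries a fine
configuration `U⋆ V` in its fibre (`Ū(U⋆ V) = V`) inside the loop α-guard at which `ρ` is continuous and positive, then `∀ V ∈ Dom, 0 < TcanOfRecord F N K k ρ V` —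
at the record `U⋆ V := V^{(k)}(V)` ([I] (2.3)), `Dom := domAlt_{k+1}`, the inclusion being `hreg`. [cite: Balaban1987RG1, (2.3) p.265, (0.19) p.255 and p.259] -/
theorem TcanOfRecord_pos_on_of_localRoute (hk : k < K) {α : ℝ} (hα24 : α ≤ 1 / 24) (hαδ : α < deltaSU (Fin N))
    (hαL : 157 * α < (((F.P K).L : ℝ) ^ ((F.P K).d - 1))⁻¹) {ρ : Density (F.P K) k (SU N)}
    (hρm : Measurable ρ) (hρ0 : ∀ U, 0 ≤ ρ U) (hρi : Integrable ρ (fieldMeasure (F.P K) k (SU N)))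
    {Dom : Set (PBond (F.P K) (k + 1) → SU N)} (hDom : Dom ⊆ regSetOfRecord F N K k ρ)
    (Ustar : (PBond (F.P K) (k + 1) → SU N) → GaugeField (F.P K) k (SU N))
    (havg : ∀ V ∈ Dom, (avOfRecord F N K k).avg (Ustar V) = V)
    (hUα : ∀ V ∈ Dom, ∀ c i, dist1 (loopHol (Ustar V) c i) ≤ α)
    (hρc : ∀ V ∈ Dom, ContinuousAt ρ (Ustar V)) (hρpos : ∀ V ∈ Dom, 0 < ρ (Ustar V)) :
    ∀ V ∈ Dom, 0 < TcanOfRecord F N K k ρ V :=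
  fun V hV => TcanOfRecord_pos_of_localRoute_of_avg_eq hk hα24 hαδ hαL hρm hρ0 hρi (havg V hV) (hUα V hV) (hρc V hV) (hρpos V hV)
    (hDom hV)

end Positive

/-! ## §3 At the β-input of record: the critical configuration `V^{(k)}(V)` as the local positivity witness -/

section BetaInput

variable {K k : ℕ}

/-- ★★★ **(F3) ON THE LOCAL ROUTE AT THE β-INPUT `ρ_k = χ^{(2.9)}_k·exp[−GF_k∕g_k² + A_k]`** (any transport family `T`, history `g`, numerics `ν`, threshold `0 < ε₁`).
For a solvable coarse field `V` ([B11] Thm 1, displayed) whose critical configuration `V^{(k)}(V)` ([I] (2.3)) lies in the loop α-guard (Prop 2-type smallness, displayed), with the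
critical letters `U ↦ V^{(k)}(Ū)(b)` at the non-distinguished bonds, `GF_k` and `A_k` continuous at `V^{(k)}(V)` (N07 ∕ the tower, displayed), and `V` in the maximal regular
set of the transform of `ρ_k` (`hreg`, displayed), `ρ_k` measurable and integrable ((H-U), (I19)): `0 < TcanOfRecord F N K k ρ_k V`.  The witness: `Ū(V^{(k)}(V)) = V` (`avg_critCfgOfRecord`), `ρ_k(V^{(k)}(V)) > 0`
(`betaInput_chi29_critCfgOfRecord_pos`: every fluctuation variable vanishes there), `ρ_k` continuous at `V^{(k)}(V)` (dag-n09-w2 g5's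
`continuousAt_betaInput_chi29_of_forall_ne`: no threshold is active where all deviations vanish). [cite: Balaban1987RG1, (2.3) p.265, (2.9) p.266, (0.19) p.255 and p.259] -/
theorem TcanOfRecord_betaInput_chi29_pos_of_localRoute (ν : Stage7Numerics) {ε₁ : ℝ} (hε : 0 < ε₁) (T : Transport F N) (g : ℕ → ℝ)
    (hk : k < K) {α : ℝ} (hα24 : α ≤ 1 / 24) (hαδ : α < deltaSU (Fin N)) (hαL : 157 * α < (((F.P K).L : ℝ) ^ ((F.P K).d - 1))⁻¹)
    (hρm : Measurable (betaInputOfRecord F N T (chiFixed29 F N ν ε₁) K g k))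
    (hint : Integrable (betaInputOfRecord F N T (chiFixed29 F N ν ε₁) K g k) (fieldMeasure (F.P K) k (SU N)))
    {V : PBond (F.P K) (k + 1) → SU N} (hsol : UkExists F N K (k + 1) ν.εreg V)
    (hUα : ∀ c i, dist1 (loopHol (critCfgOfRecord F N ν K k V) c i) ≤ α)
    (hcrit : ∀ b : PBond (F.P K) k, ¬ IsB0 b →
      ContinuousAt (fun U : GaugeField (F.P K) k (SU N) => critCfgOfRecord F N ν K k ((avOfRecord F N K k).avg U) b) (critCfgOfRecord F N ν K k V))
    (hGF : ContinuousAt (gfOfRecord F N K k) (critCfgOfRecord F N ν K k V))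
    (hA : ContinuousAt (effActionHT F N T (chiFixed29 F N ν ε₁) K g k) (critCfgOfRecord F N ν K k V))
    (hreg : V ∈ regSetOfRecord F N K k (betaInputOfRecord F N T (chiFixed29 F N ν ε₁) K g k)) :
    0 < TcanOfRecord F N K k (betaInputOfRecord F N T (chiFixed29 F N ν ε₁) K g k) V :=
  TcanOfRecord_pos_of_localRoute_of_avg_eq hk hα24 hαδ hαL hρm (betaInput_chi29_nonneg ν ε₁ T K g k) hint (avg_critCfgOfRecord hsol) hUα
    (continuousAt_betaInput_chi29_of_forall_ne ν ε₁ T K g k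
      (fun b hb => continuousAt_fluctDevOfRecord_of_continuousAt_crit ν b (hcrit b hb))
      (fun b _ => by rw [fluctDevOfRecord_critCfgOfRecord ν hsol b]; exact hε.ne) hGF hA)
    (betaInput_chi29_critCfgOfRecord_pos ν hε T K g hsol) hreg

/-- ★★ **THE TOWER'S `hpos` BINDER ON THE NEXT SMALL-FIELD DOMAIN, AT THE STAGE-13 RECORD** (`TβOfRecord₁₃ = TcanOfRecord`, `chiβOfRecord₁₃ θ = chiFixed29 θ.ν θ.ε₂₉`,
history `gOfRecord₁₃ θ P`; `ρ_j` the step-`j` β-input): `∀ V ∈ domAlt_{j+1}, 0 < TβOfRecord₁₃ F N P.K j ρ_j V` — from `hreg_j` (road B, dag-n09-w3's junction), [B11] solvability on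
the domain, the α-guard of the critical configurations, hcrit ∕ `GF_j` ∕ `A_j` continuity at them, `ρ_j` measurable and integrable ((H-U), (I19)), `0 < θ.ε₂₉`.  ALL DISPLAYED; nothing of Bałaban's
asserted. [cite: Balaban1987RG1, (2.3) p.265, (0.19) p.255 and p.259] -/
theorem TβOfRecord₁₃_betaInput_pos_on_domAlt_of_localRoute (θ : Stage13Params F N) (P : B12.RunParams) {j : ℕ} (hj : j < P.K)
    (hε : 0 < θ.ε₂₉) {α : ℝ} (hα24 : α ≤ 1 / 24) (hαδ : α < deltaSU (Fin N)) (hαL : 157 * α < (((F.P P.K).L : ℝ) ^ ((F.P P.K).d - 1))⁻¹)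
    (hρm : Measurable (betaInputOfRecord F N (TβOfRecord₁₃ F N) (chiβOfRecord₁₃ F N θ) P.K (gOfRecord₁₃ F N θ P) j))
    (hint : Integrable (betaInputOfRecord F N (TβOfRecord₁₃ F N) (chiβOfRecord₁₃ F N θ) P.K (gOfRecord₁₃ F N θ P) j) (fieldMeasure (F.P P.K) j (SU N)))
    (hsolν : ∀ W ∈ domAltOfRecord F N θ.ν P.K (j + 1), UkExists F N P.K (j + 1) θ.ν.εreg W)
    (hcritα : ∀ V ∈ domAltOfRecord F N θ.ν P.K (j + 1), ∀ c i, dist1 (loopHol (critCfgOfRecord F N θ.ν P.K j V) c i) ≤ α)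
    (hcrit : ∀ V ∈ domAltOfRecord F N θ.ν P.K (j + 1), ∀ b : PBond (F.P P.K) j, ¬ IsB0 b →
      ContinuousAt (fun U : GaugeField (F.P P.K) j (SU N) => critCfgOfRecord F N θ.ν P.K j ((avOfRecord F N P.K j).avg U) b)
        (critCfgOfRecord F N θ.ν P.K j V))
    (hGF : ∀ V ∈ domAltOfRecord F N θ.ν P.K (j + 1), ContinuousAt (gfOfRecord F N P.K j) (critCfgOfRecord F N θ.ν P.K j V))
    (hA : ∀ V ∈ domAltOfRecord F N θ.ν P.K (j + 1),
      ContinuousAt (effActionHT F N (TβOfRecord₁₃ F N) (chiβOfRecord₁₃ F N θ) P.K (gOfRecord₁₃ F N θ P) j) (critCfgOfRecord F N θ.ν P.K j V))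
    (hreg : domAltOfRecord F N θ.ν P.K (j + 1) ⊆
      regSetOfRecord F N P.K j (betaInputOfRecord F N (TβOfRecord₁₃ F N) (chiβOfRecord₁₃ F N θ) P.K (gOfRecord₁₃ F N θ P) j)) :
    ∀ V ∈ domAltOfRecord F N θ.ν P.K (j + 1),
      0 < TβOfRecord₁₃ F N P.K j (betaInputOfRecord F N (TβOfRecord₁₃ F N) (chiβOfRecord₁₃ F N θ) P.K (gOfRecord₁₃ F N θ P) j) V :=
  fun V hV => TcanOfRecord_betaInput_chi29_pos_of_localRoute θ.ν hε (TβOfRecord₁₃ F N) (gOfRecord₁₃ F N θ P) hj hα24 hαδ hαL hρm hint (hsolν V hV)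
    (hcritα V hV) (hcrit V hV) (hGF V hV) (hA V hV) (hreg hV)

end BetaInput

end Summit.QuantumFields.YangMills.BalabanUVNodes.N09TransportPositiveOfLocalRoute

end
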